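import Summits.QuantumFields.YangMills.Theorems.LuscherReductionTwistedTraceScalingBOCentralRatesEight
import Summits.QuantumFields.YangMills.Theorems.LuscherReductionTwistedTraceScalingBTRatesKappa
import HarnessLib

/-!
# (D2) RATES AT WEIGHT `β^{1/3}` for the central transfer with the SHARP smearing window (crux K1 `NearFlatRatioLaw`, stub `stub_C1rate`)
# (explicit-unit seat `ym-line-ftr-p1` g19)

Lane A's `…BOCentralRatesSeven` / `…RatesEight` prove, for every factor `f` and tail `t` of the two-sided bound of record, the WEIGHTED limits
`(f − 1)·W → 0`, `t·W → 0` with `W = β^{1/5}`.  For `stub_C1rate` (`η = O(β^{-1/3})`) we need the weight `W₃(β) = powScale (−1/3) β = max(β,1)^{1/3}`: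
this file is the VERBATIM port of their weight-specific lemmas (`…_w3`; the weight-generic algebra `wt_mul`, … and the weight-free dominations
`sliceTail_le`, `gaussTail_le`, `farTail_le`, `schedRho_le`, `tendsto_transport_defect_abstract_weighted` are reused), the atoms needing `p > 1/3`
(all schedule-B atoms have `p ≥ 1/2`), plus §3b the NEW atom: the smearing exponent of `…CentralRecordThree.central_transfer_record_three`
(`δu = β^{-1/2}ℓ³`, `σ = β^{-1}`) is `≤ (45L+1)⁴ℓ¹²β^{-1/2}·(750|E| + 5115N₃ + 2923236N_P)` (`sharp_recordExponent_le`), hence an atom with `p = 1/2`.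
HONEST FRAMING: rate bookkeeping toward stub_C1rate (OPEN); crux K1 OPEN; R2b1 is a RECORD rung; no summit statement is proved; the YM gap is NOT proved.
-/

open MeasureTheory Filter Topology Real
open scoped BigOperators
open Literature.MathematicalPhysics.QuantumFieldTheory
open Literature.MathematicalPhysics.QuantumLattice

namespace Summit.QuantumFields.YangMills.Theorems.FemtoTransferGap.TwoLattice.ConstTube

open Summit.QuantumFields.YangMills.Theorems.FemtoTransferGap
open Summit.QuantumFields.YangMills.Theorems.FemtoTransferGap.TwoLattice
open Summit.QuantumFields.YangMills.Theorems.TwistedTraceScaling.Negative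
open Summit.QuantumFields.YangMills.Theorems.FemtoTransferGap.TwoLattice.Stiff
open Summit.QuantumFields.YangMills.Theorems.FemtoTransferGap.TwoLattice.GnChart

variable {L : ℕ}

/-! ## §2 The weight `W = max(β,1)^{1/5}` and the generic atom -/

/-- `β^{-p}·W = β^{-(p − 1/3)}`. [folklore] -/
theorem powScale_mul_weight_w3 (p β : ℝ) : powScale p β * powScale (-(1 / 3)) β = powScale (p - 1 / 3) β := by
  rw [powScale_mul_powScale]; ring_nf

/-- `0 < W`. [folklore] -/
theorem weight_pos_w3 (β : ℝ) : 0 < powScale (-(1 / 3)) β := powScale_pos _ _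

/-- `β^{-1/3}·W = 1`. [folklore] -/
theorem powScale_fifth_mul_weight_w3 (β : ℝ) : powScale (1 / 3) β * powScale (-(1 / 3)) β = 1 := by
  rw [powScale_mul_powScale]; norm_num [powScale]

/-- ★ **Generic weighted atom**: `0 ≤ f ≤ C·β^{-p}ℓ^k` eventually with `p > 1/3` ⇒ `f·W → 0` and `f → 0`. [folklore] -/
theorem zt_atom_w3 {f : ℝ → ℝ} {C p : ℝ} {k : ℕ} (hp : 1 / 3 < p)
    (h : ∀ᶠ β : ℝ in atTop, 0 ≤ f β ∧ f β ≤ C * (powScale p β * btLog β ^ k)) :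
    Tendsto (fun β => f β * powScale (-(1 / 3)) β) atTop (𝓝 0) ∧ Tendsto f atTop (𝓝 0) := by
  have hp0 : 0 < p := by linarith
  have hup0 : Tendsto (fun β : ℝ => C * (powScale p β * btLog β ^ k)) atTop (𝓝 0) := by
    simpa using (tendsto_powScale_mul_btLog_pow hp0 k).const_mul C
  have hupW : Tendsto (fun β : ℝ => C * (powScale (p - 1 / 3) β * btLog β ^ k)) atTop (𝓝 0) := by
    simpa using (tendsto_powScale_mul_btLog_pow (by linarith : 0 < p - 1 / 3) k).const_mul C
  constructor
  · refine tendsto_of_tendsto_of_tendsto_of_le_of_le' tendsto_const_nhds hupW ?_ ?_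
    · filter_upwards [h] with β hβ
      exact mul_nonneg hβ.1 (weight_pos_w3 β).le
    · filter_upwards [h] with β hβ
      calc f β * powScale (-(1 / 3)) β ≤ C * (powScale p β * btLog β ^ k) * powScale (-(1 / 3)) β :=
            mul_le_mul_of_nonneg_right hβ.2 (weight_pos_w3 β).le
        _ = C * (powScale (p - 1 / 3) β * btLog β ^ k) := by rw [← powScale_mul_weight_w3]; ring
  · refine tendsto_of_tendsto_of_tendsto_of_le_of_le' tendsto_const_nhds hup0 ?_ ?_
    · filter_upwards [h] with β hβ; exact hβ.1
    · filter_upwards [h] with β hβ; exact hβ.2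


/-! ## §3 The polynomial atoms of schedule B at weight `β^{1/3}` -/

section Atoms

variable [NeZero L]

omit [NeZero L] in
/-- Atom `ρ² ≤ 64(45L+1)²·β^{-1}ℓ⁴`: `ρ²·W → 0`. [folklore] -/
theorem zt_rho_sq_w3 :
    Tendsto (fun β : ℝ => (8 * (9 * (L : ℝ) * (5 * (powScale (1 / 2) β * btLog β ^ 2)) + powScale 1 β)) ^ 2 * powScale (-(1 / 3)) β) atTop (𝓝 0) ∧
      Tendsto (fun β : ℝ => (8 * (9 * (L : ℝ) * (5 * (powScale (1 / 2) β * btLog β ^ 2)) + powScale 1 β)) ^ 2) atTop (𝓝 0) := by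
  refine zt_atom_w3 (C := 64 * (45 * (L : ℝ) + 1) ^ 2) (p := 1) (k := 4) (by norm_num) ?_
  filter_upwards [eventually_ge_atTop (1 : ℝ)] with β hβ
  obtain ⟨hρ0, hρ⟩ := schedRho_le (L := L) hβ
  refine ⟨sq_nonneg _, ?_⟩
  have h1 : powScale (1 / 2) β * powScale (1 / 2) β = powScale 1 β := by rw [powScale_mul_powScale]; norm_num
  calc (8 * (9 * (L : ℝ) * (5 * (powScale (1 / 2) β * btLog β ^ 2)) + powScale 1 β)) ^ 2
      ≤ (8 * (45 * (L : ℝ) + 1) * (powScale (1 / 2) β * btLog β ^ 2)) ^ 2 := pow_le_pow_left₀ hρ0 hρ 2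
    _ = 64 * (45 * (L : ℝ) + 1) ^ 2 * ((powScale (1 / 2) β * powScale (1 / 2) β) * btLog β ^ 4) := by ring
    _ = 64 * (45 * (L : ℝ) + 1) ^ 2 * (powScale 1 β * btLog β ^ 4) := by rw [h1]

omit [NeZero L] in
/-- Atom `βρ³ ≤ 512(45L+1)³·β^{-1/2}ℓ⁶`: `βρ³·W → 0`. [folklore] -/
theorem zt_beta_rho_cube_w3 :
    Tendsto (fun β : ℝ => β * (8 * (9 * (L : ℝ) * (5 * (powScale (1 / 2) β * btLog β ^ 2)) + powScale 1 β)) ^ 3 * powScale (-(1 / 3)) β) atTop (𝓝 0) ∧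
      Tendsto (fun β : ℝ => β * (8 * (9 * (L : ℝ) * (5 * (powScale (1 / 2) β * btLog β ^ 2)) + powScale 1 β)) ^ 3) atTop (𝓝 0) := by
  refine zt_atom_w3 (C := 512 * (45 * (L : ℝ) + 1) ^ 3) (p := 1 / 2) (k := 6) (by norm_num) ?_
  filter_upwards [eventually_ge_atTop (1 : ℝ)] with β hβ
  obtain ⟨hρ0, hρ⟩ := schedRho_le (L := L) hβ
  have hβ0 : 0 ≤ β := by linarith
  refine ⟨by positivity, ?_⟩
  have h2 : β * powScale (1 / 2) β ^ 2 = 1 := mul_powScale_half_sq hβ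
  calc β * (8 * (9 * (L : ℝ) * (5 * (powScale (1 / 2) β * btLog β ^ 2)) + powScale 1 β)) ^ 3
      ≤ β * (8 * (45 * (L : ℝ) + 1) * (powScale (1 / 2) β * btLog β ^ 2)) ^ 3 := by gcongr
    _ = 512 * (45 * (L : ℝ) + 1) ^ 3 * (powScale (1 / 2) β * btLog β ^ 6) * (β * powScale (1 / 2) β ^ 2) := by ring
    _ = 512 * (45 * (L : ℝ) + 1) ^ 3 * (powScale (1 / 2) β * btLog β ^ 6) := by rw [h2, mul_one]

omit [NeZero L] in
/-- Atom `βρ⁴ ≤ 4096(45L+1)⁴·β^{-1}ℓ⁸`: `βρ⁴·W → 0`. [folklore] -/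
theorem zt_beta_rho_four_w3 :
    Tendsto (fun β : ℝ => β * (8 * (9 * (L : ℝ) * (5 * (powScale (1 / 2) β * btLog β ^ 2)) + powScale 1 β)) ^ 4 * powScale (-(1 / 3)) β) atTop (𝓝 0) ∧
      Tendsto (fun β : ℝ => β * (8 * (9 * (L : ℝ) * (5 * (powScale (1 / 2) β * btLog β ^ 2)) + powScale 1 β)) ^ 4) atTop (𝓝 0) := by
  refine zt_atom_w3 (C := 4096 * (45 * (L : ℝ) + 1) ^ 4) (p := 1) (k := 8) (by norm_num) ?_
  filter_upwards [eventually_ge_atTop (1 : ℝ)] with β hβ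
  obtain ⟨hρ0, hρ⟩ := schedRho_le (L := L) hβ
  have hβ0 : 0 ≤ β := by linarith
  refine ⟨by positivity, ?_⟩
  have h2 : β * powScale (1 / 2) β ^ 2 = 1 := mul_powScale_half_sq hβ
  have h1 : powScale (1 / 2) β * powScale (1 / 2) β = powScale 1 β := by rw [powScale_mul_powScale]; norm_num
  calc β * (8 * (9 * (L : ℝ) * (5 * (powScale (1 / 2) β * btLog β ^ 2)) + powScale 1 β)) ^ 4
      ≤ β * (8 * (45 * (L : ℝ) + 1) * (powScale (1 / 2) β * btLog β ^ 2)) ^ 4 := by gcongr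
    _ = 4096 * (45 * (L : ℝ) + 1) ^ 4 * ((powScale (1 / 2) β * powScale (1 / 2) β) * btLog β ^ 8) * (β * powScale (1 / 2) β ^ 2) := by ring
    _ = 4096 * (45 * (L : ℝ) + 1) ^ 4 * (powScale 1 β * btLog β ^ 8) := by rw [h2, mul_one, h1]

omit [NeZero L] in
/-- Atom `(P)`: `C·(1·β^{-1/4})²·W → 0` for every real `C`. [folklore] -/
theorem zt_defect_w3 (C : ℝ) :
    Tendsto (fun β : ℝ => C * (1 * powScale (1 / 4) β) ^ 2 * powScale (-(1 / 3)) β) atTop (𝓝 0) ∧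
      Tendsto (fun β : ℝ => C * (1 * powScale (1 / 4) β) ^ 2) atTop (𝓝 0) := by
  have hsq : Tendsto (fun β : ℝ => (1 * powScale (1 / 4) β) ^ 2 * powScale (-(1 / 3)) β) atTop (𝓝 0) ∧
      Tendsto (fun β : ℝ => (1 * powScale (1 / 4) β) ^ 2) atTop (𝓝 0) := by
    refine zt_atom_w3 (C := 1) (p := 1 / 2) (k := 0) (by norm_num) (Eventually.of_forall fun β => ⟨sq_nonneg _, ?_⟩)
    have h1 : powScale (1 / 4) β * powScale (1 / 4) β = powScale (1 / 2) β := by rw [powScale_mul_powScale]; norm_num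
    rw [one_mul, pow_zero, mul_one, one_mul, sq, h1]
  exact zt_const_mul C hsq

omit [NeZero L] in
/-- Atom `882βT²R_in² ≤ (882/144)(45L+1)²·β^{-1}ℓ⁶` (`R_in = r_f/12`, `r_f ≤ β^{-1/2}ℓ`): `·W → 0`. [folklore] -/
theorem zt_loc_w3 :
    Tendsto (fun β : ℝ => 882 * β * (9 * (L : ℝ) * (5 * (powScale (1 / 2) β * btLog β ^ 2)) + powScale 1 β) ^ 2 *
        (min (1 / 40) (powScale (1 / 2) β * btLog β) / 12) ^ 2 * powScale (-(1 / 3)) β) atTop (𝓝 0) ∧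
      Tendsto (fun β : ℝ => 882 * β * (9 * (L : ℝ) * (5 * (powScale (1 / 2) β * btLog β ^ 2)) + powScale 1 β) ^ 2 *
        (min (1 / 40) (powScale (1 / 2) β * btLog β) / 12) ^ 2) atTop (𝓝 0) := by
  refine zt_atom_w3 (C := 882 / 144 * (45 * (L : ℝ) + 1) ^ 2) (p := 1) (k := 6) (by norm_num) ?_
  filter_upwards [eventually_ge_atTop (1 : ℝ)] with β hβ
  have hβ0 : 0 ≤ β := by linarith
  have hβT := R52.beta_schedT_sq_le (L := L) hβ
  have hℓ := one_le_btLog β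
  have hx := (powScale_pos (1 / 2) β).le
  have hmin0 : 0 ≤ min (1 / 40) (powScale (1 / 2) β * btLog β) := le_min (by norm_num) (by positivity)
  refine ⟨by positivity, ?_⟩
  have hm : (min (1 / 40) (powScale (1 / 2) β * btLog β) / 12) ^ 2 ≤ (powScale (1 / 2) β * btLog β / 12) ^ 2 := by
    gcongr; exact min_le_right _ _
  have h1 : powScale (1 / 2) β * powScale (1 / 2) β = powScale 1 β := by rw [powScale_mul_powScale]; norm_num
  have hT2 : 0 ≤ β * (9 * (L : ℝ) * (5 * (powScale (1 / 2) β * btLog β ^ 2)) + powScale 1 β) ^ 2 := by positivity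
  calc 882 * β * (9 * (L : ℝ) * (5 * (powScale (1 / 2) β * btLog β ^ 2)) + powScale 1 β) ^ 2 * (min (1 / 40) (powScale (1 / 2) β * btLog β) / 12) ^ 2
      = 882 * (β * (9 * (L : ℝ) * (5 * (powScale (1 / 2) β * btLog β ^ 2)) + powScale 1 β) ^ 2) * (min (1 / 40) (powScale (1 / 2) β * btLog β) / 12) ^ 2 := by ring
    _ ≤ 882 * ((45 * (L : ℝ) + 1) ^ 2 * btLog β ^ 4) * (powScale (1 / 2) β * btLog β / 12) ^ 2 := by gcongr
    _ = 882 / 144 * (45 * (L : ℝ) + 1) ^ 2 * ((powScale (1 / 2) β * powScale (1 / 2) β) * btLog β ^ 6) := by ring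
    _ = 882 / 144 * (45 * (L : ℝ) + 1) ^ 2 * (powScale 1 β * btLog β ^ 6) := by rw [h1]

end Atoms

/-! ## §4 The weighted transport defects -/

/-- ★ **The weighted transport defects vanish on schedule B**: both exponents `ε_q + ε_tr` of `central_transfer_record(_two)` times `W = β^{1/3}`
tend to `0`, for all real `B, M_T, C_L, K_sp`. [folklore] -/
theorem zt_transport_defects_w3 [NeZero L] (Ksp MT B CL : ℝ) :
    Tendsto (fun β : ℝ => (((96 * (β / 2) + (β)) * (B * (powScale 1 β * btLog β ^ 3) + MT * (powScale 1 β * btLog β ^ 3) ^ 2) * (2 * ((((min (1 / 40) (powScale (1 / 2) β * btLog β)) / 12) + (9 / 10 * (min (1 / 40) (powScale (1 / 2) β * btLog β)))) + 14 * ((Fintype.card (Edge 3 L) : ℝ)) * (8 * (9 * (L : ℝ) * (5 * (powScale (1 / 2) β * btLog β ^ 2)) + (powScale 1 β))) ^ 2 + (CL * ((4 + 48 * Ksp) * (8 * (9 * (L : ℝ) * (5 * (powScale (1 / 2) β * btLog β ^ 2)) + (powScale 1 β)))) * (9 * Ksp * (8 * (9 * (L : ℝ) * (5 * (powScale (1 /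 2) β * btLog β ^ 2)) + (powScale 1 β)))) + MT * (9 * Ksp * (8 * (9 * (L : ℝ) * (5 * (powScale (1 / 2) β * btLog β ^ 2)) + (powScale 1 β)))) ^ 2)) + (B * (powScale 1 β * btLog β ^ 3) + MT * (powScale 1 β * btLog β ^ 3) ^ 2))) + ((96 * (β / 2) + (β)) * ((CL * ((4 + 48 * Ksp) * (8 * (9 * (L : ℝ) * (5 * (powScale (1 / 2) β * btLog β ^ 2)) + (powScale 1 β)))) * (9 * Ksp * (8 * (9 * (L : ℝ) * (5 * (powScale (1 / 2) β * btLog β ^ 2)) + (powScale 1 β)))) + MT * (9 * Ksp * (8 * (9 * (L : ℝ) * (5 * (powScale (1 / 2) β * btLog β ^ 2)) + (powScale 1 β)))) ^ 2) * (2 * ((((min (1 / 40) (powScale (1 / 2) β * btLog β)) / 12) + (9 / 10 * (min (1 / 40) (powScale (1 / 2) β * btLog β)))) + 14 * ((Fintype.card (Edge 3 L) : ℝ)) * (8 * (9 * (L : ℝ) * (5 * (powScale (1 / 2) β * btLog β ^ 2)) + (powScale 1 β))) ^ 2 + (CL * ((4 + 48 * Ksp) * (8 * (9 * (L : ℝ)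 * (5 * (powScale (1 / 2) β * btLog β ^ 2)) + (powScale 1 β)))) * (9 * Ksp * (8 * (9 * (L : ℝ) * (5 * (powScale (1 / 2) β * btLog β ^ 2)) + (powScale 1 β)))) + MT * (9 * Ksp * (8 * (9 * (L : ℝ) * (5 * (powScale (1 / 2) β * btLog β ^ 2)) + (powScale 1 β)))) ^ 2)) + (CL * ((4 + 48 * Ksp) * (8 * (9 * (L : ℝ) * (5 * (powScale (1 / 2) β * btLog β ^ 2)) + (powScale 1 β)))) * (9 * Ksp * (8 * (9 * (L : ℝ) * (5 * (powScale (1 / 2) β * btLog β ^ 2)) + (powScale 1 β)))) + MT * (9 * Ksp * (8 * (9 * (L : ℝ) * (5 * (powScale (1 / 2) β * btLog β ^ 2)) + (powScale 1 β)))) ^ 2)) + 72 * ((Fintype.card (Edge 3 L) : ℝ)) * (8 * (9 * (L : ℝ) * (5 * (powScale (1 / 2) β * btLog β ^ 2)) + (powScale 1 β))) ^ 3))) * powScale (-(1 / 3)) β) atTop (𝓝 0) ∧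
      Tendsto (fun β : ℝ => (((96 * (β / 2) + (β)) * (B * (powScale 1 β * btLog β ^ 3) + MT * (powScale 1 β * btLog β ^ 3) ^ 2) * (2 * (Real.sqrt ((Fintype.card (Edge 3 L) : ℝ)) * (8 * (9 * (L : ℝ) * (5 * (powScale (1 / 2) β * btLog β ^ 2)) + (powScale 1 β))) + (7 * ((Fintype.card (Edge 3 L) : ℝ)) * (8 * (9 * (L : ℝ) * (5 * (powScale (1 / 2) β * btLog β ^ 2)) + (powScale 1 β))) + B * (9 * Ksp * (8 * (9 * (L : ℝ) * (5 * (powScale (1 / 2) β * btLog β ^ 2)) + (powScale 1 β)))) + MT * (9 * Ksp * (8 * (9 * (L : ℝ) * (5 * (powScale (1 / 2) β * btLog β ^ 2)) + (powScale 1 β)))) ^ 2)) + (B * (powScale 1 β * btLog β ^ 3) + MT * (powScale 1 β * btLog β ^ 3) ^ 2))) + ((96 * (β / 2) + (β)) * ((CL * ((4 + 48 * Ksp) * (8 * (9 * (L : ℝ) * (5 * (powScale (1 / 2) β * btLog β ^ 2)) + (powScale 1 β)))) * (9 * Ksp * (8 * (9 * (L : ℝ) * (5 * (powScale (1 / 2)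 β * btLog β ^ 2)) + (powScale 1 β)))) + MT * (9 * Ksp * (8 * (9 * (L : ℝ) * (5 * (powScale (1 / 2) β * btLog β ^ 2)) + (powScale 1 β)))) ^ 2) * (2 * (Real.sqrt ((Fintype.card (Edge 3 L) : ℝ)) * (8 * (9 * (L : ℝ) * (5 * (powScale (1 / 2) β * btLog β ^ 2)) + (powScale 1 β))) + (7 * ((Fintype.card (Edge 3 L) : ℝ)) * (8 * (9 * (L : ℝ) * (5 * (powScale (1 / 2) β * btLog β ^ 2)) + (powScale 1 β))) + B * (9 * Ksp * (8 * (9 * (L : ℝ) * (5 * (powScale (1 / 2) β * btLog β ^ 2)) + (powScale 1 β)))) + MT * (9 * Ksp * (8 * (9 * (L : ℝ) * (5 * (powScale (1 / 2) β * btLog β ^ 2)) + (powScale 1 β)))) ^ 2)) + (CL * ((4 + 48 * Ksp) * (8 * (9 * (L : ℝ) * (5 * (powScale (1 / 2) β * btLog β ^ 2)) + (powScale 1 β)))) * (9 * Ksp * (8 * (9 * (L : ℝ) * (5 * (powScale (1 / 2) β * btLog β ^ 2)) + (powScale 1 β)))) + MT * (9 * Ksp * (8 * (9 * (L : ℝ)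 * (5 * (powScale (1 / 2) β * btLog β ^ 2)) + (powScale 1 β)))) ^ 2)) + 72 * ((Fintype.card (Edge 3 L) : ℝ)) * (8 * (9 * (L : ℝ) * (5 * (powScale (1 / 2) β * btLog β ^ 2)) + (powScale 1 β))) ^ 3))) * powScale (-(1 / 3)) β) atTop (𝓝 0) := by
  -- the six weighted atoms on schedule B
  have hr0 : ∀ β : ℝ, 1 ≤ β → β * (powScale 1 β * btLog β ^ 3) = btLog β ^ 3 := fun β hβ => by
    rw [← mul_assoc, mul_powScale_one hβ, one_mul]
  have h1 : Tendsto (fun β : ℝ => β * (powScale 1 β * btLog β ^ 3) * (8 * (9 * (L : ℝ) * (5 * (powScale (1 / 2) β * btLog β ^ 2)) + powScale 1 β)) * powScale (-(1 / 3)) β) atTop (𝓝 0) := by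
    refine (zt_atom_w3 (C := 8 * (45 * (L : ℝ) + 1)) (p := 1 / 2) (k := 5) (by norm_num) ?_).1
    filter_upwards [eventually_ge_atTop (1 : ℝ)] with β hβ
    obtain ⟨hρ0, hρ⟩ := schedRho_le (L := L) hβ
    have hℓ : 0 ≤ btLog β := le_trans zero_le_one (one_le_btLog β)
    rw [hr0 β hβ]
    refine ⟨by positivity, ?_⟩
    calc btLog β ^ 3 * (8 * (9 * (L : ℝ) * (5 * (powScale (1 / 2) β * btLog β ^ 2)) + powScale 1 β)) ≤ btLog β ^ 3 * (8 * (45 * (L : ℝ) + 1) * (powScale (1 / 2) β * btLog β ^ 2)) :=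
          mul_le_mul_of_nonneg_left hρ (by positivity)
      _ = 8 * (45 * (L : ℝ) + 1) * (powScale (1 / 2) β * btLog β ^ 5) := by ring
  have h2 : Tendsto (fun β : ℝ => β * (powScale 1 β * btLog β ^ 3) ^ 2 * powScale (-(1 / 3)) β) atTop (𝓝 0) := by
    refine (zt_atom_w3 (C := 1) (p := 1) (k := 6) (by norm_num) ?_).1
    filter_upwards [eventually_ge_atTop (1 : ℝ)] with β hβ
    have hℓ : 0 ≤ btLog β := le_trans zero_le_one (one_le_btLog β)
    have hβ0 : 0 ≤ β := by linarith
    have h10 := (powScale_pos 1 β).le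
    refine ⟨by positivity, le_of_eq ?_⟩
    calc β * (powScale 1 β * btLog β ^ 3) ^ 2 = (β * (powScale 1 β * btLog β ^ 3)) * (powScale 1 β * btLog β ^ 3) := by ring
      _ = 1 * (powScale 1 β * btLog β ^ 6) := by rw [hr0 β hβ]; ring
  have h3 : Tendsto (fun β : ℝ => β * (powScale 1 β * btLog β ^ 3) * min (1 / 40) (powScale (1 / 2) β * btLog β) * powScale (-(1 / 3)) β) atTop (𝓝 0) := by
    refine (zt_atom_w3 (C := 1) (p := 1 / 2) (k := 4) (by norm_num) ?_).1
    filter_upwards [eventually_ge_atTop (1 : ℝ)] with β hβ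
    have hℓ : 0 ≤ btLog β := le_trans zero_le_one (one_le_btLog β)
    have hx := (powScale_pos (1 / 2) β).le
    have hmin0 : 0 ≤ min (1 / 40) (powScale (1 / 2) β * btLog β) := le_min (by norm_num) (by positivity)
    rw [hr0 β hβ]
    refine ⟨by positivity, ?_⟩
    calc btLog β ^ 3 * min (1 / 40) (powScale (1 / 2) β * btLog β) ≤ btLog β ^ 3 * (powScale (1 / 2) β * btLog β) :=
          mul_le_mul_of_nonneg_left (min_le_right _ _) (by positivity)
      _ = 1 * (powScale (1 / 2) β * btLog β ^ 4) := by ring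
  have h4 : Tendsto (fun β : ℝ => β * (8 * (9 * (L : ℝ) * (5 * (powScale (1 / 2) β * btLog β ^ 2)) + powScale 1 β)) ^ 2 *
      min (1 / 40) (powScale (1 / 2) β * btLog β) * powScale (-(1 / 3)) β) atTop (𝓝 0) := by
    refine (zt_atom_w3 (C := 64 * (45 * (L : ℝ) + 1) ^ 2) (p := 1 / 2) (k := 5) (by norm_num) ?_).1
    filter_upwards [eventually_ge_atTop (1 : ℝ)] with β hβ
    obtain ⟨hρ0, hρ⟩ := schedRho_le (L := L) hβ
    have hℓ : 0 ≤ btLog β := le_trans zero_le_one (one_le_btLog β)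
    have hx := (powScale_pos (1 / 2) β).le
    have hβ0 : 0 ≤ β := by linarith
    have hmin0 : 0 ≤ min (1 / 40) (powScale (1 / 2) β * btLog β) := le_min (by norm_num) (by positivity)
    have h2' : β * powScale (1 / 2) β ^ 2 = 1 := mul_powScale_half_sq hβ
    refine ⟨by positivity, ?_⟩
    calc β * (8 * (9 * (L : ℝ) * (5 * (powScale (1 / 2) β * btLog β ^ 2)) + powScale 1 β)) ^ 2 * min (1 / 40) (powScale (1 / 2) β * btLog β)
        ≤ β * (8 * (45 * (L : ℝ) + 1) * (powScale (1 / 2) β * btLog β ^ 2)) ^ 2 * (powScale (1 / 2) β * btLog β) := by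
          gcongr; exact min_le_right _ _
      _ = 64 * (45 * (L : ℝ) + 1) ^ 2 * (powScale (1 / 2) β * btLog β ^ 5) * (β * powScale (1 / 2) β ^ 2) := by ring
      _ = 64 * (45 * (L : ℝ) + 1) ^ 2 * (powScale (1 / 2) β * btLog β ^ 5) := by rw [h2', mul_one]
  exact tendsto_transport_defect_abstract_weighted (r := fun β => powScale 1 β * btLog β ^ 3)
    (ρ := fun β => 8 * (9 * (L : ℝ) * (5 * (powScale (1 / 2) β * btLog β ^ 2)) + powScale 1 β))
    (rf := fun β => min (1 / 40) (powScale (1 / 2) β * btLog β)) (W := fun β => powScale (-(1 / 3)) β) tendsto_schedCore tendsto_schedRho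
    h1 h2 h3 h4 (zt_beta_rho_cube_w3 (L := L)).1 (zt_beta_rho_four_w3 (L := L)).1 B MT CL Ksp ((Fintype.card (Edge 3 L) : ℝ)) (Real.sqrt ((Fintype.card (Edge 3 L) : ℝ)))


/-! ## §5 Exponentially small tails absorb the weight -/

/-- `W = e^{ℓ/3}` eventually (`β ≥ e`). [folklore] -/
theorem eventually_weight_eq_exp_w3 : ∀ᶠ β : ℝ in atTop, powScale (-(1 / 3)) β = Real.exp (btLog β / 3) := by
  filter_upwards [eventually_btLog_eq, eventually_ge_atTop (1 : ℝ)] with β hℓ hβ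
  have hβ0 : 0 < β := by linarith
  rw [powScale_eq hβ, neg_neg, Real.rpow_def_of_pos hβ0, hℓ]
  ring_nf

/-- ★ **Generic weighted tail**: `0 ≤ t ≤ C·e^{-ℓ}` eventually ⇒ `t·W → 0` and `t → 0` (`e^{-ℓ}·W = e^{-2ℓ/3}`). [folklore] -/
theorem zt_of_le_exp_neg_w3 {t : ℝ → ℝ} (C : ℝ) (h : ∀ᶠ β : ℝ in atTop, 0 ≤ t β ∧ t β ≤ C * Real.exp (-btLog β)) :
    Tendsto (fun β => t β * powScale (-(1 / 3)) β) atTop (𝓝 0) ∧ Tendsto t atTop (𝓝 0) := by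
  have hC : ∀ᶠ β : ℝ in atTop, 0 ≤ C := by
    filter_upwards [h] with β hβ
    by_contra hC
    push Not at hC
    have : C * Real.exp (-btLog β) < 0 := mul_neg_of_neg_of_pos hC (Real.exp_pos _)
    linarith [hβ.1, hβ.2]
  have he1 : Tendsto (fun β : ℝ => C * Real.exp (-btLog β)) atTop (𝓝 0) := by
    simpa using (Real.tendsto_exp_atBot.comp (tendsto_neg_atTop_atBot.comp tendsto_btLog_atTop)).const_mul C
  have he2 : Tendsto (fun β : ℝ => C * Real.exp (-(2 / 3 * btLog β))) atTop (𝓝 0) := by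
    have h45 : Tendsto (fun β : ℝ => 2 / 3 * btLog β) atTop atTop := tendsto_btLog_atTop.const_mul_atTop (by norm_num)
    simpa using (Real.tendsto_exp_atBot.comp (tendsto_neg_atTop_atBot.comp h45)).const_mul C
  constructor
  · refine tendsto_of_tendsto_of_tendsto_of_le_of_le' tendsto_const_nhds he2 ?_ ?_
    · filter_upwards [h] with β hβ; exact mul_nonneg hβ.1 (weight_pos_w3 β).le
    · filter_upwards [h, eventually_weight_eq_exp_w3, hC] with β hβ hW hC0
      rw [hW]
      calc t β * Real.exp (btLog β / 3) ≤ C * Real.exp (-btLog β) * Real.exp (btLog β / 3) :=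
            mul_le_mul_of_nonneg_right hβ.2 (Real.exp_pos _).le
        _ = C * Real.exp (-(2 / 3 * btLog β)) := by rw [mul_assoc, ← Real.exp_add]; ring_nf
  · refine tendsto_of_tendsto_of_tendsto_of_le_of_le' tendsto_const_nhds he1 ?_ ?_
    · filter_upwards [h] with β hβ; exact hβ.1
    · filter_upwards [h] with β hβ; exact hβ.2


section Weighted

variable [NeZero L]

/-- ★ Slice Laplace tail × Gaussian loss, weighted. [folklore] -/
theorem zt_sliceTail_mul_gaussLoss_w3 (KD Ksp : ℝ) :
    Tendsto (fun β : ℝ => (1 + KD * ((4 + 48 * Ksp) * (8 * (9 * (L : ℝ) * (5 * (powScale (1 / 2) β * btLog β ^ 2)) + powScale 1 β))) ^ 2) *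
        (4 : ℝ) ^ (flatDim L / 2 : ℝ) * Real.exp (-((1 / (4 * sliceConst L)) ^ 2 * (powScale 1 β * btLog β ^ 3) ^ 2 / (4 * (powScale 1 β) ^ 2))) *
      Real.exp ((96 * (β / 2) + β) * (Real.sqrt ((Fintype.card (Edge 3 L) : ℝ)) * (8 * (9 * (L : ℝ) * (5 * (powScale (1 / 2) β * btLog β ^ 2)) + powScale 1 β))) ^ 2) *
      powScale (-(1 / 3)) β) atTop (𝓝 0) ∧
    Tendsto (fun β : ℝ => (1 + KD * ((4 + 48 * Ksp) * (8 * (9 * (L : ℝ) * (5 * (powScale (1 / 2) β * btLog β ^ 2)) + powScale 1 β))) ^ 2) *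
        (4 : ℝ) ^ (flatDim L / 2 : ℝ) * Real.exp (-((1 / (4 * sliceConst L)) ^ 2 * (powScale 1 β * btLog β ^ 3) ^ 2 / (4 * (powScale 1 β) ^ 2))) *
      Real.exp ((96 * (β / 2) + β) * (Real.sqrt ((Fintype.card (Edge 3 L) : ℝ)) * (8 * (9 * (L : ℝ) * (5 * (powScale (1 / 2) β * btLog β ^ 2)) + powScale 1 β))) ^ 2))
      atTop (𝓝 0) :=
  zt_of_le_exp_neg_w3 _ (sliceTail_mul_gaussLoss_le (L := L) KD Ksp)

/-- ★ Slice Laplace tail, weighted. [folklore] -/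
theorem zt_sliceTail_w3 (KD Ksp : ℝ) :
    Tendsto (fun β : ℝ => (1 + KD * ((4 + 48 * Ksp) * (8 * (9 * (L : ℝ) * (5 * (powScale (1 / 2) β * btLog β ^ 2)) + powScale 1 β))) ^ 2) *
        (4 : ℝ) ^ (flatDim L / 2 : ℝ) * Real.exp (-((1 / (4 * sliceConst L)) ^ 2 * (powScale 1 β * btLog β ^ 3) ^ 2 / (4 * (powScale 1 β) ^ 2))) *
      powScale (-(1 / 3)) β) atTop (𝓝 0) ∧
    Tendsto (fun β : ℝ => (1 + KD * ((4 + 48 * Ksp) * (8 * (9 * (L : ℝ) * (5 * (powScale (1 / 2) β * btLog β ^ 2)) + powScale 1 β))) ^ 2) *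
        (4 : ℝ) ^ (flatDim L / 2 : ℝ) * Real.exp (-((1 / (4 * sliceConst L)) ^ 2 * (powScale 1 β * btLog β ^ 3) ^ 2 / (4 * (powScale 1 β) ^ 2))))
      atTop (𝓝 0) :=
  zt_of_le_exp_neg_w3 _ (sliceTail_le (L := L) KD Ksp)

/-- ★ Relative Gaussian tail of the lower bound, weighted. [folklore] -/
theorem zt_gaussTail_w3 :
    Tendsto (fun β : ℝ => Real.exp (49 * β * (min (1 / 40) (powScale (1 / 2) β * btLog β) / 12) ^ 2) *
      (Real.exp (-(β * (min (8 * (9 * (L : ℝ) * (5 * (powScale (1 / 2) β * btLog β ^ 2)) + powScale 1 β) -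
          2 * (9 * (L : ℝ) * (5 * (powScale (1 / 2) β * btLog β ^ 2)) + powScale 1 β))
          (9 / 10 * min (1 / 40) (powScale (1 / 2) β * btLog β) -
            6 * (9 * (L : ℝ) * (5 * (powScale (1 / 2) β * btLog β ^ 2)) + powScale 1 β) ^ 2 * (min (1 / 40) (powScale (1 / 2) β * btLog β) / 12))) ^ 2 / 2)) *
        (π / (β / 2)) ^ ((Module.finrank ℝ (LinkSpace L) : ℝ) / 2)) / stiffGaussTop L (β / 2) β * powScale (-(1 / 3)) β) atTop (𝓝 0) ∧
    Tendsto (fun β : ℝ => Real.exp (49 * β * (min (1 / 40) (powScale (1 / 2) β * btLog β) / 12) ^ 2) *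
      (Real.exp (-(β * (min (8 * (9 * (L : ℝ) * (5 * (powScale (1 / 2) β * btLog β ^ 2)) + powScale 1 β) -
          2 * (9 * (L : ℝ) * (5 * (powScale (1 / 2) β * btLog β ^ 2)) + powScale 1 β))
          (9 / 10 * min (1 / 40) (powScale (1 / 2) β * btLog β) -
            6 * (9 * (L : ℝ) * (5 * (powScale (1 / 2) β * btLog β ^ 2)) + powScale 1 β) ^ 2 * (min (1 / 40) (powScale (1 / 2) β * btLog β) / 12))) ^ 2 / 2)) *
        (π / (β / 2)) ^ ((Module.finrank ℝ (LinkSpace L) : ℝ) / 2)) / stiffGaussTop L (β / 2) β) atTop (𝓝 0) :=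
  zt_of_le_exp_neg_w3 _ (gaussTail_le (L := L))

/-- ★ Gauge-far term, weighted. [folklore] -/
theorem zt_farTail_w3 :
    Tendsto (fun β : ℝ => Real.exp (-(β * (8 * (9 * (L : ℝ) * (5 * (powScale (1 / 2) β * btLog β ^ 2)) + powScale 1 β)) ^ 2 / 4)) *
        Real.exp (49 * β * (min (1 / 40) (powScale (1 / 2) β * btLog β) / 12) ^ 2) / stiffGaussTop L (β / 2) β /
      (((2 * π ^ 2)⁻¹) ^ Fintype.card (Edge 3 L) * fpZ (powScale 1 β) * fpWeightBar L (powScale 1 β)) * powScale (-(1 / 3)) β) atTop (𝓝 0) ∧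
    Tendsto (fun β : ℝ => Real.exp (-(β * (8 * (9 * (L : ℝ) * (5 * (powScale (1 / 2) β * btLog β ^ 2)) + powScale 1 β)) ^ 2 / 4)) *
        Real.exp (49 * β * (min (1 / 40) (powScale (1 / 2) β * btLog β) / 12) ^ 2) / stiffGaussTop L (β / 2) β /
      (((2 * π ^ 2)⁻¹) ^ Fintype.card (Edge 3 L) * fpZ (powScale 1 β) * fpWeightBar L (powScale 1 β))) atTop (𝓝 0) :=
  zt_of_le_exp_neg_w3 _ (farTail_le (L := L))

end Weighted

end Summit.QuantumFields.YangMills.Theorems.FemtoTransferGap.TwoLattice.ConstTube
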